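import Literature.Analysis.FluidPDE.PineauVicolRSSHolds
import HarnessLib

/-!
# Crux `FrequencyRigidity` (stmt-NavierStokesRegularity-2955), line `scaled-energy-split`:
# sub-goal (B) of Stub 2 — the rotated-self-similar case outside Pineau–Vicol's window

Helper file (`--supports stmt-NavierStokesRegularity-2955`; theorems only, sorry-free).  Stub
`stub_finiteRSSExtremes`: for every decay constant `C₀ > 0` there are `α₁, α₂ > 0` such that no
classical unit-viscosity Navier–Stokes flow `(v, q)` on `ℝ³ × (−∞, 0)` of rotated-self-similar
form `v(t, x) = (−t)^{−1/2} R(αs) U(R(−αs) x/√(−t))`, `s = −log(−t)` (Pineau–Vicol 2026, (1.7);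
the tree's `pvAnsatz α (fun y _ => U y)`), with a decaying profile `‖U(y)‖ ≤ C₀/(1 + ‖y‖)` and
angular speed `|α| < α₁` or `|α| > α₂`, carries a positive weighted enstrophy
`∫ ‖curl v(t)‖² K(t) > 0` at all negative times (for ANY weight `K`).

Proof.  Restrict the solution to the printed time set `[−1, 0)` (`IsClassicalNSSolutionOn.mono`);
the profile decay is equivalent to the Type I bound (1.10) with the same constant (Remark 1.2,
`PineauVicol2026.typeI_iff_norm_profile_le_rss`); the profile `U = v(−1)` (`pvAnsatz_neg_one`)
is a smooth slice of the classical solution, in particular `C²`.  Pineau–Vicol 2026, Thm. 1.4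
— PROVED in the tree as `pineauVicol2026_rss_liouville_holds` — forces `U ≡ 0`, so `v(−1) = 0`,
`curl v(−1) ≡ 0`, and the weighted enstrophy at `t = −1` vanishes, contradicting its positivity.

## References

* B. Pineau, V. Vicol, *On rotated backwards self-similar solutions of the incompressible 3D
  Navier–Stokes equations*, arXiv:2607.09619 (2026), Theorem 1.4 (p. 4), Remark 1.2 (pp. 3–4).
  [PineauVicol2026]
-/

noncomputable section

-- the registered stub namespace repeats the summit name `NavierStokesRegularity` (summit = problem)
set_option linter.dupNamespace false

namespace Summit.NavierStokesRegularity.NavierStokesRegularity.Theorems.FrequencyRigidity.ScaledEnergySplit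

open Literature.Analysis.FluidPDE MeasureTheory Set Filter Topology Function
open scoped ContDiff

/-! ## Bookkeeping: an RSS flow on `(−∞, 0)` seen on Pineau–Vicol's time set `[−1, 0)` -/

variable {α C₀ : ℝ} {U : EuclideanSpace ℝ (Fin 3) → EuclideanSpace ℝ (Fin 3)}
  {v : ℝ → EuclideanSpace ℝ (Fin 3) → EuclideanSpace ℝ (Fin 3)}
  {q : ℝ → EuclideanSpace ℝ (Fin 3) → ℝ}

/-- A classical solution on `(−∞, 0)` restricts to a classical solution on `[−1, 0)` (a set of
unique differentiability, `uniqueDiffOn_Ico`). [folklore] -/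
theorem rssExtremes_isClassicalNSSolutionOn_Ico
    (hsol : IsClassicalNSSolutionOn (Iio (0 : ℝ)) 1 0 v q) :
    IsClassicalNSSolutionOn (Ico (-1 : ℝ) 0) 1 0 v q :=
  hsol.mono Ico_subset_Iio_self (uniqueDiffOn_Ico (-1) 0)

/-- The RSS ansatz on `(−∞, 0)` restricted to `[−1, 0)`. [folklore] -/
theorem rssExtremes_ansatz_Ico
    (hA : ∀ t ∈ Iio (0 : ℝ), ∀ x, v t x = pvAnsatz α (fun y _ => U y) t x) :
    ∀ t ∈ Ico (-1 : ℝ) 0, ∀ x, v t x = pvAnsatz α (fun y _ => U y) t x :=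
  fun t ht x => hA t ht.2 x

/-- **Remark 1.2 of the source, (1.9) ⇒ (1.10).** An RSS flow whose profile decays like
`‖U(y)‖ ≤ C₀/(1 + ‖y‖)` obeys the Type I bound `‖v(t, x)‖ ≤ C₀/(‖x‖ + √(−t))` on
`ℝ³ × [−1, 0)`, with the same constant (`PineauVicol2026.typeI_iff_norm_profile_le_rss`).
[cite: PineauVicol2026, Remark 1.2 (pp. 3–4)] -/
theorem rssExtremes_typeI_of_decay
    (hA : ∀ t ∈ Iio (0 : ℝ), ∀ x, v t x = pvAnsatz α (fun y _ => U y) t x)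
    (hdec : ∀ y, ‖U y‖ ≤ C₀ / (1 + ‖y‖)) :
    ∀ t ∈ Ico (-1 : ℝ) 0, ∀ x, ‖v t x‖ ≤ C₀ / (‖x‖ + Real.sqrt (-t)) := by
  intro t ht x
  rw [hA t ht.2 x]
  exact (PineauVicol2026.typeI_iff_norm_profile_le_rss (α := α) (C₀ := C₀)).2 hdec t ht x

/-- At `t = −1` (`s = 0`, `R(0) = 1`) an RSS flow IS its profile: `v(−1) = U`
(`pvAnsatz_neg_one`). [cite: PineauVicol2026, Remark 1.3 (p. 4)] -/
theorem rssExtremes_slice_neg_one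
    (hA : ∀ t ∈ Iio (0 : ℝ), ∀ x, v t x = pvAnsatz α (fun y _ => U y) t x) : v (-1) = U :=
  funext fun x => by rw [hA (-1) (by norm_num) x, pvAnsatz_neg_one]

/-- Hence the profile of a classical RSS flow on `(−∞, 0)` is `C²` (indeed `C^∞`: it is the time
slice `v(−1)` of a jointly smooth field, `IsClassicalNSSolutionOn.contDiff_velocity`).
[folklore] -/
theorem rssExtremes_contDiff_profile (hsol : IsClassicalNSSolutionOn (Iio (0 : ℝ)) 1 0 v q)
    (hA : ∀ t ∈ Iio (0 : ℝ), ∀ x, v t x = pvAnsatz α (fun y _ => U y) t x) :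
    ContDiff ℝ 2 U := by
  rw [← rssExtremes_slice_neg_one hA]
  exact (hsol.contDiff_velocity (show (-1 : ℝ) ∈ Iio 0 by norm_num)).of_le (by norm_cast)

/-- An RSS flow with vanishing profile vanishes at `t = −1`, hence is irrotational there:
`curl v(−1) ≡ 0` (`curl 0 = 0`). [folklore] -/
theorem rssExtremes_curl_neg_one_eq_zero
    (hA : ∀ t ∈ Iio (0 : ℝ), ∀ x, v t x = pvAnsatz α (fun y _ => U y) t x) (hU0 : U = 0)
    (x : EuclideanSpace ℝ (Fin 3)) : curl (v (-1)) x = 0 := by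
  rw [rssExtremes_slice_neg_one hA, hU0]
  simp [curl]

/-! ## The stub -/

/-- **Stub `stub_finiteRSSExtremes` (sub-goal (B) of Stub 2 of the line `scaled-energy-split`):
the rotated-self-similar case outside Pineau–Vicol's window is CLOSED.**  For every decay
constant `C₀ > 0` there are `α₁, α₂ > 0` — the thresholds of Pineau–Vicol 2026, Thm. 1.4
(`pineauVicol2026_rss_liouville_holds`, proved in the tree) — such that no classical
unit-viscosity RSS flow `v = pvAnsatz α U` on `(−∞, 0)` with `‖U(y)‖ ≤ C₀/(1 + ‖y‖)` and
`|α| < α₁ ∨ α₂ < |α|` has positive weighted enstrophy `∫ ‖curl v(t)‖² K(t) > 0` for all `t < 0`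
(any weight `K`): on `[−1, 0)` the flow is a classical Type I (constant `C₀`, Remark 1.2) RSS
solution with the `C²` profile `U = v(−1)`, so Thm. 1.4 gives `U ≡ 0`, whence `curl v(−1) ≡ 0`
and the weighted enstrophy at `t = −1` is `0`. [cite: PineauVicol2026, Theorem 1.4 (arXiv:2607.09619 p. 4)] -/
theorem stub_finiteRSSExtremes : ∀ C₀ : ℝ, 0 < C₀ → ∃ α₁ α₂ : ℝ, 0 < α₁ ∧ 0 < α₂ ∧ ∀ (α : ℝ) (U : EuclideanSpace ℝ (Fin 3) → EuclideanSpace ℝ (Fin 3)) (v : ℝ → EuclideanSpace ℝ (Fin 3) → EuclideanSpace ℝ (Fin 3)) (q : ℝ → EuclideanSpace ℝ (Fin 3) → ℝ) (K : ℝ → EuclideanSpace ℝ (Fin 3) → ℝ), Literature.Analysis.FluidPDE.IsClassicalNSSolutionOn (Set.Iio 0) 1 0 v q → (∀ t ∈ Set.Iio (0:ℝ), ∀ x, v t x = Literature.Analysis.FluidPDE.pvAnsatz α (fun y _ => U y) t x) → (∀ y, ‖U y‖ ≤ C₀ / (1 + ‖y‖)) → (∀ t ∈ Set.Iio (0:ℝ),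 0 < ∫ x, ‖Literature.Analysis.FluidPDE.curl (v t) x‖ ^ 2 * K t x) → (|α| < α₁ ∨ α₂ < |α|) → False := by
  intro C₀ hC₀
  -- Pineau–Vicol 2026, Thm. 1.4 (proved in the tree)
  obtain ⟨α₁, α₂, hα₁, hα₂, hPV⟩ := pineauVicol2026_rss_liouville_holds C₀ hC₀
  refine ⟨α₁, α₂, hα₁, hα₂, fun α U v q K hsol hA hdec hH hα => ?_⟩
  -- on `[−1, 0)`: classical, Type I with constant `C₀`, RSS with the `C²` profile `U = v(−1)`
  have hU0 : U = 0 :=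
    hPV α v q U (rssExtremes_isClassicalNSSolutionOn_Ico hsol) (rssExtremes_typeI_of_decay hA hdec)
      (rssExtremes_contDiff_profile hsol hA) (rssExtremes_ansatz_Ico hA) hα
  -- hence the weighted enstrophy at `t = −1` vanishes, contradicting its positivity
  have h1 := hH (-1) (by norm_num)
  simp [rssExtremes_curl_neg_one_eq_zero hA hU0] at h1

end Summit.NavierStokesRegularity.NavierStokesRegularity.Theorems.FrequencyRigidity.ScaledEnergySplit

end
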